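import Mathlib
import HarnessLib
import Literature.MathematicalPhysics.StatisticalMechanics.WeightDataABKM
import Literature.MathematicalPhysics.StatisticalMechanics.TorusBlocksPartial

/-!
# Theorem 7.1 (w6), second part, for the [ABKM19] weight data on the torus:
# `w_{k+1}^U(φ) ≥ w_{k:k+1}^X(φ) (W_k^{U⁺}(φ))²` ((7.54), (7.62))

The abstract tower (`WeightTowerStrong.midWeight_mul_sq_le_weight_succ`) derives
`w_{k:k+1}^X (W')² ≤ w_{k+1}^U` for `X ⊆ U*` from the single operator inequality
`2G' ⪯ δ_{k+1}M_{k+1}^U` ((7.62)).  For the torus data `abkmWeightData` with strong forms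
`G_k^Y = g_k Σ_{α∈s'} L^{2k(|α|−1)}(∇^α)ᵀ χ_k^Y ∇^α` (`χ` = box densities) and `Y = U⁺` the
scale-`(k+1)` large neighbourhood of a `(k+1)`-polymer `U`, this inequality holds as soon as
`2^{d+1} g_k θ_max² ≤ δ'_{k+1}` — because the density `χ_{k+1}^U` is `≥ 2^{−d}` wherever `χ_k^{U⁺}`
lives (every box there still contains half a block of `U` in each direction,
`TorusBlocksPartial`).  With `g_k = h_k^{−2}`, `h_k = 2^k h`, `δ'_{k+1} = δ₁4^{−(k+1)}` the
condition is `h² ≥ 2^{d+3}θ_max²/δ₁`, independent of `k` and `N`.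

* `derivForm_scale_mono` (`Σ L^{2k(..)}(∇^α)ᵀχ₁∇^α ⪯ Σ L^{2(k+1)(..)}(∇^α)ᵀχ₂∇^α` for `0 ≤ χ₁ ≤ χ₂`);
* `inv_two_pow_le_boxDensity_abkm` (`χ_{k+1}^U ≥ 2^{−d}` on `U + [−(L^{k+1}+2L^k), …]^d`);
* **`pert_sub_two_smul_strong_posSemidef`** ((7.62) for `abkmWeightData`);
* **`midWeight_mul_sq_le_weight_succ_abkm`** (Theorem 7.1 (w6), second part).

Everything is proved; no named fact.

## References
* S. Adams, S. Buchholz, R. Kotecký, S. Müller, arXiv:1910.13564, Lemma 7.6 (ii) (7.54), (7.62),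
  Theorem 7.1 (w6) [AdamsBuchholzKoteckyMuller2019].
-/

noncomputable section

namespace Literature.MathematicalPhysics.StatisticalMechanics.GradientRG

open Finset Matrix
open scoped MatrixOrder
open Literature.MathematicalPhysics.StatisticalMechanics.GradientFRD (supNorm)
open Literature.MathematicalPhysics.StatisticalMechanics.TorusPolymer
  (ball thicken mem_ball mem_thicken thicken_thicken thicken_mono thicken_mono_rad subset_thicken
    IsPolymer blockOf mem_blockOf_self)

variable {d M : ℕ} [NeZero M]

/-- **Scale monotonicity of the derivative forms**: for `L ≥ 1` and `0 ≤ χ₁ ≤ χ₂` pointwise,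
`Σ_{α∈s} L^{2k(|α|−1)}(∇^α)ᵀχ₁∇^α ⪯ Σ_{α∈s} L^{2(k+1)(|α|−1)}(∇^α)ᵀχ₂∇^α` ("`4G_{k+1} ≥ G_k`"-type
comparisons of (7.62)). [cite: AdamsBuchholzKoteckyMuller2019, Lemma 7.6 (ii) (7.62)] -/
theorem derivForm_scale_mono {L : ℝ} (hL : 1 ≤ L) (k : ℕ) (s : Finset (Fin d → ℕ))
    {χ₁ χ₂ : (Fin d → ZMod M) → ℝ} (h0 : ∀ x, 0 ≤ χ₁ x) (h : ∀ x, χ₁ x ≤ χ₂ x) :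
    (derivForm L (k + 1) s χ₂ - derivForm L k s χ₁).PosSemidef := by
  unfold derivForm
  rw [← Finset.sum_sub_distrib]
  refine Matrix.posSemidef_sum _ fun α _ => ?_
  rw [← conjDiag_smul, ← conjDiag_smul, show conjDiag (iterDiffMat α) (L ^ (2 * (k + 1) * (∑ i, α i - 1)) • χ₂) -
      conjDiag (iterDiffMat (M := M) α) (L ^ (2 * k * (∑ i, α i - 1)) • χ₁) =
    conjDiag (iterDiffMat α) (L ^ (2 * (k + 1) * (∑ i, α i - 1)) • χ₂ - L ^ (2 * k * (∑ i, α i - 1)) • χ₁)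
    from by rw [sub_eq_add_neg, ← neg_one_smul ℝ (conjDiag _ _), ← conjDiag_smul, ← conjDiag_add]; congr 1;
            funext x; simp; ring]
  refine posSemidef_conjDiag _ fun x => ?_
  simp only [Pi.sub_apply, Pi.smul_apply, smul_eq_mul, sub_nonneg]
  have h1 : L ^ (2 * k * (∑ i, α i - 1)) ≤ L ^ (2 * (k + 1) * (∑ i, α i - 1)) :=
    pow_le_pow_right₀ hL (by nlinarith)
  calc L ^ (2 * k * (∑ i, α i - 1)) * χ₁ x ≤ L ^ (2 * (k + 1) * (∑ i, α i - 1)) * χ₁ x :=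
      mul_le_mul_of_nonneg_right h1 (h0 x)
    _ ≤ L ^ (2 * (k + 1) * (∑ i, α i - 1)) * χ₂ x :=
      mul_le_mul_of_nonneg_left (h x) (by positivity)

/-- **`χ_{k+1}^U ≥ 2^{−d}` near `U⁺`**: for a `(k+1)`-polymer `U` (`M = L^N`, `L` odd,
`k + 1 ≤ N`) and `x ∈ U + [−(L^{k+1} + ρ), L^{k+1} + ρ]^d` with `2ρ ≤ L^{k+1} + 2`, the box
`x + [−2L^{k+1}, 2L^{k+1}]^d` contains at least `(L^{k+1}/2)^d` points of `U`. [cite: AdamsBuchholzKoteckyMuller2019, Lemma 7.6 (ii) (7.62)] -/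
theorem inv_two_pow_le_boxDensity_abkm {L N R k ρ : ℕ} (hLodd : Odd L) (hL1 : 1 ≤ L) (hM : M = L ^ N)
    (hk : k + 1 ≤ N) (hρ : 2 * ρ ≤ L ^ (k + 1) + 2) {U : Finset (Fin d → ZMod M)}
    (hU : IsPolymer (L ^ (k + 1)) U) {x : Fin d → ZMod M} (hx : x ∈ thicken (L ^ (k + 1) + ρ) U) :
    ((2 : ℝ) ^ d)⁻¹ ≤ boxDensity (boxRad R L (k + 1)) (boxWt (L : ℝ) d (k + 1)) U x := by
  obtain ⟨u, hu, hxu⟩ := mem_thicken.1 hx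
  set s := L ^ (k + 1) with hs
  have hs1 : 1 ≤ s := Nat.one_le_pow _ _ hL1
  have hM' : M = s * L ^ (N - (k + 1)) := by rw [hM, hs, ← pow_add]; congr 1; omega
  have hcount := TorusPolymer.pow_min_le_card_blockOf_inter_ball (d := d) hM' hLodd.pow hLodd.pow
    (r := boxRad R L (k + 1)) hxu (by simp only [boxRad]; omega)
  -- `min s (2s + 1 − (s + ρ)) = s + 1 − ρ ≥ s/2`
  set m := min s (boxRad R L (k + 1) + 1 - (L ^ (k + 1) + ρ)) with hm
  have h2m : s ≤ 2 * m := by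
    simp only [hm, boxRad, hs]
    omega
  have hsub : blockOf s u ∩ ball (boxRad R L (k + 1)) x ⊆ U :=
    (Finset.inter_subset_left).trans (hU u hu)
  have hsub' : blockOf s u ∩ ball (boxRad R L (k + 1)) x ⊆ ball (boxRad R L (k + 1)) x :=
    Finset.inter_subset_right
  have hw : 0 ≤ boxWt (L : ℝ) d (k + 1) := by unfold boxWt; positivity
  refine le_trans ?_ (le_boxDensity_of_subset hw hsub hsub')
  -- `2^{-d} ≤ L^{-(k+1)d} · m^d`
  have hcard : ((m ^ d : ℕ) : ℝ) ≤ ((blockOf s u ∩ ball (boxRad R L (k + 1)) x).card : ℝ) := by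
    exact_mod_cast hcount
  have hsr : (0 : ℝ) < (s : ℝ) := by exact_mod_cast hs1
  have h2mr : (s : ℝ) ≤ 2 * m := by exact_mod_cast h2m
  rw [boxWt]
  calc ((2 : ℝ) ^ d)⁻¹ = ((L : ℝ) ^ ((k + 1) * d))⁻¹ * (((L : ℝ) ^ (k + 1)) / 2) ^ d := by
        rw [div_pow, ← pow_mul, div_eq_mul_inv, ← mul_assoc, inv_mul_cancel₀ (by positivity), one_mul]
    _ ≤ ((L : ℝ) ^ ((k + 1) * d))⁻¹ * ((m ^ d : ℕ) : ℝ) := by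
        refine mul_le_mul_of_nonneg_left ?_ (by positivity)
        push_cast
        refine pow_le_pow_left₀ (by positivity) ?_ d
        have : ((L : ℝ) ^ (k + 1)) = (s : ℝ) := by rw [hs]; push_cast; ring
        rw [this]; linarith
    _ ≤ _ := mul_le_mul_of_nonneg_left hcard (by positivity)

/-- **(7.62) for the torus weight data**: for a `(k+1)`-polymer `U` (`M = L^N`, `L` odd,
`L ≥ 2^{d+3} + 16R`, `k + 1 ≤ N`), strong-form orders `s' ⊆ {1 ≤ |α| ≤ M_ord}` and a coefficient
`g ≥ 0` with `2^{d+1} g θ_max² ≤ δ'_{k+1}`: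
`pert_{k+1}^U − 2·(g Σ_{α∈s'} L^{2k(|α|−1)}(∇^α)ᵀ χ_k^{U⁺} ∇^α) ⪰ 0`, `U⁺ = U + [−L^{k+1}, L^{k+1}]^d`.
[cite: AdamsBuchholzKoteckyMuller2019, Lemma 7.6 (ii) (7.62)] -/
theorem pert_sub_two_smul_strong_posSemidef {L N Mord R k : ℕ} (hLodd : Odd L)
    (hL : 2 ^ (d + 3) + 16 * R ≤ L) (hR : 2 ≤ R) (hM : M = L ^ N) (hk : k + 1 ≤ N) (θbar : ℝ)
    {δ' : ℕ → ℝ} (𝒞 : ℕ → (Fin d → ZMod M) → ℝ) {s' : Finset (Fin d → ℕ)} (hs' : s' ⊆ diffIndex d Mord)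
    {g : ℝ} (hg : 0 ≤ g) (hgδ : 2 ^ (d + 1) * g * thetaMax R d ^ 2 ≤ δ' (k + 1))
    {U : Finset (Fin d → ZMod M)} (hU : IsPolymer (L ^ (k + 1)) U) :
    ((abkmWeightData L N Mord R θbar δ' 𝒞).pert (k + 1) U -
      (2 : ℝ) • (g • derivForm (L : ℝ) k s'
        (boxDensity (boxRad R L k) (boxWt (L : ℝ) d k) (thicken (plusRad R L (k + 1)) U)))).PosSemidef := by
  have hL8 : 2 ^ (d + 3) ≤ L := le_trans (Nat.le_add_right _ _) hL
  have hL64 : 2 ^ 3 ≤ 2 ^ (d + 3) := Nat.pow_le_pow_right (by norm_num) (by omega)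
  have hL4 : 4 ≤ L := by omega
  have hL1 : (1 : ℝ) ≤ L := by exact_mod_cast (show 1 ≤ L by omega)
  have hθ := thetaMax_pos R d
  have hδ : 0 ≤ δ' (k + 1) := le_trans (by positivity) hgδ
  set χU := boxDensity (boxRad R L (k + 1)) (boxWt (L : ℝ) d (k + 1)) U with hχU
  set χP := boxDensity (boxRad R L k) (boxWt (L : ℝ) d k) (thicken (plusRad R L (k + 1)) U) with hχP
  have hwU : 0 ≤ boxWt (L : ℝ) d (k + 1) := by unfold boxWt; positivity
  have hwP : 0 ≤ boxWt (L : ℝ) d k := by unfold boxWt; positivity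
  rw [abkmWeightData, geomWeightData_pert, derivForm_eq_add_sdiff (L : ℝ) (k + 1) hs', smul_add, smul_smul,
    ← derivForm_smul, ← derivForm_smul, ← derivForm_smul, add_sub_right_comm]
  refine Matrix.PosSemidef.add ?_ (posSemidef_derivForm (by positivity) _ _ fun x => ?_)
  swap
  · rw [Pi.smul_apply, smul_eq_mul]
    exact mul_nonneg (div_nonneg hδ hθ.le) (boxDensity_nonneg _ hwU U x)
  refine derivForm_scale_mono hL1 k s' (fun x => ?_) fun x => ?_
  · rw [Pi.smul_apply, smul_eq_mul]
    exact mul_nonneg (mul_nonneg (by norm_num) hg) (boxDensity_nonneg _ hwP _ x)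
  · -- pointwise: `2g χ_k^{U⁺}(x) ≤ (δ'/θmax) χ_{k+1}^U(x)`
    simp only [Pi.smul_apply, smul_eq_mul]
    by_cases hx : χP x = 0
    · rw [hx, mul_zero]
      exact mul_nonneg (div_nonneg hδ hθ.le) (boxDensity_nonneg _ (by unfold boxWt; positivity) U x)
    · -- `x` lies within `L^{k+1} + 2L^k` of `U`, where `χ_{k+1}^U ≥ 2^{-d}`; and `χ_k^{U⁺} ≤ θmax`
      have hxmem : x ∈ thicken (L ^ (k + 1) + boxRad R L k) U := by
        have h1 := mem_thicken_of_boxDensity_ne_zero hx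
        have h2 := thicken_thicken (boxRad R L k) (plusRad R L (k + 1)) U h1
        refine thicken_mono_rad (le_of_eq ?_) U h2
        simp only [plusRad]; ring
      have hρ : 2 * boxRad R L k ≤ L ^ (k + 1) + 2 := by
        cases k with
        | zero => simp only [boxRad, zero_add, pow_one]; omega
        | succ j =>
          simp only [boxRad]
          rw [pow_succ L (j + 1)]; nlinarith [Nat.one_le_pow (j + 1) L (by omega)]
      have hlow := inv_two_pow_le_boxDensity_abkm (R := R) hLodd (by omega) hM hk hρ hU hxmem
      have hup := boxDensity_abkm_le (d := d) (M := M) hR (by omega : 1 ≤ L) k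
        (thicken (plusRad R L (k + 1)) U) x
      rw [← hχP] at hup; rw [← hχU] at hlow
      -- `2 g χP ≤ 2 g θmax ≤ (δ'/θmax) 2^{-d} ≤ (δ'/θmax) χU`
      have h3 : 2 * g * thetaMax R d ≤ δ' (k + 1) / thetaMax R d * ((2 : ℝ) ^ d)⁻¹ := by
        rw [div_mul_eq_mul_div, le_div_iff₀ hθ, ← div_eq_mul_inv, le_div_iff₀ (by positivity)]
        calc 2 * g * thetaMax R d * thetaMax R d * 2 ^ d = 2 ^ (d + 1) * g * thetaMax R d ^ 2 := by ring
          _ ≤ δ' (k + 1) := hgδ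
      calc 2 * g * χP x ≤ 2 * g * thetaMax R d := mul_le_mul_of_nonneg_left hup (by positivity)
        _ ≤ δ' (k + 1) / thetaMax R d * ((2 : ℝ) ^ d)⁻¹ := h3
        _ ≤ δ' (k + 1) / thetaMax R d * χU x := mul_le_mul_of_nonneg_left hlow (div_nonneg hδ hθ.le)

/-- **[ABKM19] Theorem 7.1 (w6), second part, for the torus weight data**: for a `(k+1)`-polymer
`U`, `X ⊆ U*`, and strong forms `G_k^Y = g Σ_{α∈s'}L^{2k(|α|−1)}(∇^α)ᵀχ_k^Y∇^α` with
`2^{d+1}gθ_max² ≤ δ'_{k+1}`: `w_{k:k+1}^X(φ) · (W_k^{U⁺}(φ))² ≤ w_{k+1}^U(φ)`.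
[cite: AdamsBuchholzKoteckyMuller2019, Theorem 7.1 (w6)] -/
theorem midWeight_mul_sq_le_weight_succ_abkm {L N Mord R k : ℕ} (hLodd : Odd L)
    (hL : 2 ^ (d + 3) + 16 * R ≤ L) (hR : 2 ≤ R) (hM : M = L ^ N) (hk : k + 1 ≤ N) {θbar : ℝ}
    {δ' : ℕ → ℝ} {𝒞 : ℕ → (Fin d → ZMod M) → ℝ}
    {D : ℕ → Matrix (Fin d → ZMod M) (Fin d → ZMod M) ℝ}
    (hD : (abkmWeightData L N Mord R θbar δ' 𝒞).Dominated D)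
    (hm : (abkmWeightData L N Mord R θbar δ' 𝒞).Monotone) {s' : Finset (Fin d → ℕ)}
    (hs' : s' ⊆ diffIndex d Mord) {g : ℝ} (hg : 0 ≤ g)
    (hgδ : 2 ^ (d + 1) * g * thetaMax R d ^ 2 ≤ δ' (k + 1)) {U X : Finset (Fin d → ZMod M)}
    (hU : IsPolymer (L ^ (k + 1)) U) (hXU : X ⊆ thicken (starRad R L d (k + 1)) U)
    (φ : (Fin d → ZMod M) → ℝ) :
    (abkmWeightData L N Mord R θbar δ' 𝒞).midWeight k X φ *
        expWeight (g • derivForm (L : ℝ) k s'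
          (boxDensity (boxRad R L k) (boxWt (L : ℝ) d k) (thicken (plusRad R L (k + 1)) U))) φ ^ 2 ≤
      (abkmWeightData L N Mord R θbar δ' 𝒞).weight (k + 1) U φ :=
  WeightData.midWeight_mul_sq_le_weight_succ hD hm hXU
    (pert_sub_two_smul_strong_posSemidef hLodd hL hR hM hk θbar 𝒞 hs' hg hgδ hU) φ

end Literature.MathematicalPhysics.StatisticalMechanics.GradientRG

end
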